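import Mathlib.LinearAlgebra.Dimension.Finite
import Mathlib.LinearAlgebra.Span.Defs
import Literature.Computability.AlgebraicComplexity.MatrixMultiplicationExponent
import HarnessLib

/-!
# The asymptotic spectrum of tensors: universal spectral points

Topic `Literature/Computability/AlgebraicComplexity`; definition request
`defn-IsUniversalSpectralPoint` (route `MatrixMultiplication/AsymptoticSpectrum`, item
`stmt-MatrixMultiplication-0581`). Coordinate 3-tensors are arrays `ι → κ → μ → K` as in
`MatrixMultiplicationExponent` (`triad`, `tensorRank`, `matMulTensor`).

## Content (Christandl–Vrana–Zuiddam, JAMS 36 (2023) = arXiv:1709.07851, §1.1–§1.2; Strassen 1988)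

* `kroneckerTensor s t` — the tensor (Kronecker) product `s ⊗ t` on product index types,
  entry `s a b c * t a' b' c'` (CVZ §1.1: `(v₁⊗w₁, v₂⊗w₂, v₃⊗w₃) ↦ f(v) g(w)`).
* `kroneckerPow t N` — the power `t^{⊗N}` on index types `Fin N → ι`.
* `directSumTensor s t` — the direct sum `s ⊕ t` on sum index types (CVZ §1.1, p. 4).
* `unitTensor K n` — the unit (diagonal) tensor `⟨n⟩ = ∑ᵢ eᵢ ⊗ eᵢ ⊗ eᵢ` (CVZ §1.1, p. 4).
* `TensorRestrictsTo t s` — the restriction preorder `t ≥ s`: `s = (A ⊗ B ⊗ C) t` for linear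
  maps `A, B, C` (CVZ §1.1: "`f` restricts to `g`, `f ≥ g`, if there are linear maps
  `Aᵢ : F^{mᵢ} → F^{nᵢ}` such that `g = f ∘ (A₁, A₂, A₃)`").
* `subrank t = Q(t) = max {s | ⟨s⟩ ≤ t}`, `asymptoticRank t = R̃(t)`, `asymptoticSubrank t = Q̃(t)`
  (CVZ §1.1, p. 5).
* `IsUniversalSpectralPoint K F` — CVZ §1.2, p. 7: "Elements of `Δ(T)` are called *universal
  spectral points*, and they correspond precisely to maps `ξ : {k-tensors over F} → ℝ≥0`
  satisfying `ξ(s ⊕ t) = ξ(s) + ξ(t)`, `ξ(s ⊗ t) = ξ(s)ξ(t)`, `ξ(⟨1⟩) = 1`, and `ξ(s) ≤ ξ(t)`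
  whenever `s ≤ t`."
* `gaugePoint₁/₂/₃` — the flattening ranks (CVZ Example 1.4; Strassen 1988, eq. (3.10)).

Named facts (statements only): `strassen_duality_asymptoticRank` /
`strassen_duality_asymptoticSubrank` (CVZ Prop. 1.6 = Strassen 1988, Thm. 3.8:
`R̃(a) = max_{ξ ∈ Δ} ξ(a)`, `Q̃(a) = min_{ξ ∈ Δ} ξ(a)`), and
`gaugePoint_isUniversalSpectralPoint` (CVZ Example 1.4; Strassen 1988, (3.10)).

## Design choices

* **The type of a spectral map.** A universal spectral point is a function on *all* 3-tensors
  over `K`; here `F : SpectralMap K := ∀ ⦃ι κ μ : Type⦄, (ι → κ → μ → K) → ℝ` (index types in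
  `Type`, which contains all `Fin n` and their products/sums — every finite format up to
  reindexing). The axioms are imposed only for finite index types (`Fintype`); values of `F` on
  infinite index types are unconstrained junk and never used. Reindexing invariance need not be
  postulated: a reindexed tensor restricts to the original and back (permutation matrices), so
  monotonicity gives equality of `F`-values.
* Codomain `ℝ` with the axiom `0 ≤ F t` instead of `ℝ≥0` (same content as CVZ's `→ ℝ≥0`; keeps
  `asymptoticRank`, stated in `ℝ`, coercion-free).
* Normalisation `F ⟨1⟩ = 1` (CVZ p. 7, the universal-point form) rather than `F ⟨n⟩ = n`
  (CVZ (d)); they agree by additivity since `⟨n⟩ ≅ ⟨1⟩^{⊕ n}`.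
* `asymptoticRank` is defined as `inf_N R(t^{⊗N})^{1/N}` and `asymptoticSubrank` as
  `sup_N Q(t^{⊗N})^{1/N}`; by Fekete's lemma (`R` sub-, `Q` super-multiplicative) these are the
  limits of CVZ p. 5 (Strassen 1988, §1). Junk: `Real.sSup`/`sInf` conventions (`0` for unbounded
  sets); `R(t^{⊗N})^{1/N} ≥ 0` so the infimum is honest; `Q(t^{⊗N}) ≤ |ι|^N` (a theorem, not
  proved here) makes the supremum honest for finite formats.
* `subrank` is `sSup` over `ℕ` of `{s | t ≥ ⟨s⟩}` (contains `0`; bounded by `min(|ι|,|κ|,|μ|)`, a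
  theorem not proved here — were it unbounded, `Nat.sSup` would return the junk `0`).

## Sources

* M. Christandl, P. Vrana, J. Zuiddam, *Universal points in the asymptotic spectrum of tensors*,
  J. Amer. Math. Soc. 36 (2023) 31–79, arXiv:1709.07851: §1.1 (pp. 3–5), §1.2 (pp. 6–7),
  Prop. 1.6 and Remark 1.7 (p. 8), Example 1.4 (p. 7).
* V. Strassen, *The asymptotic spectrum of tensors*, J. reine angew. Math. 384 (1988) 102–152,
  Thm. 3.8 (duality), eq. (3.10) (gauge points) — cited through CVZ.
* M. Bläser, *Fast Matrix Multiplication*, ToC Graduate Surveys 5 (2013), §9.2 (asymptotic rank).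

## Mathlib search

`Matrix.kroneckerMap` exists for matrices only; no 3-tensor Kronecker product, restriction
preorder, unit tensor, (asymptotic) subrank or asymptotic spectrum at the pin (searched
`kronecker`, `subrank`, `asymptoticRank`, `unitTensor`, `Strassen`). Used: `Module.finrank`,
`Submodule.span`, `Real.rpow`, `iInf`/`iSup`, `Finset.sum`.
-/

noncomputable section

open scoped BigOperators

namespace Literature.Computability.AlgebraicComplexity

universe u

/-! ## Operations on coordinate 3-tensors -/

section Operations

variable {K : Type u} [CommSemiring K]
variable {ι κ μ ι' κ' μ' : Type*}

/-- The **tensor (Kronecker) product** `s ⊗ t` of 3-tensors `s ∈ K^{ι×κ×μ}`, `t ∈ K^{ι'×κ'×μ'}`: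
the tensor on `(ι×ι') × (κ×κ') × (μ×μ')` with entry `s a b c * t a' b' c'`
(CVZ §1.1: `f ⊗ g : (v₁⊗w₁, v₂⊗w₂, v₃⊗w₃) ↦ f(v₁,v₂,v₃) g(w₁,w₂,w₃)`; Bläser 2013, §7). [cite: ChristandlVranaZuiddam2023, §1.1] -/
def kroneckerTensor (s : ι → κ → μ → K) (t : ι' → κ' → μ' → K) :
    ι × ι' → κ × κ' → μ × μ' → K :=
  fun a b c => s a.1 b.1 c.1 * t a.2 b.2 c.2

/-- Entries of the Kronecker product. [folklore] -/
@[simp] theorem kroneckerTensor_apply (s : ι → κ → μ → K) (t : ι' → κ' → μ' → K)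
    (a : ι × ι') (b : κ × κ') (c : μ × μ') :
    kroneckerTensor s t a b c = s a.1 b.1 c.1 * t a.2 b.2 c.2 := rfl

/-- The **tensor power** `t^{⊗N}` on index types `Fin N → ι` etc.: entry `∏ᵢ t (a i) (b i) (c i)`
(CVZ §1.1, `f^{⊗n}`). For `N = 0` this is the scalar `1` on singleton index types (`≅ ⟨1⟩`). [cite: ChristandlVranaZuiddam2023, §1.1] -/
def kroneckerPow (t : ι → κ → μ → K) (N : ℕ) :
    (Fin N → ι) → (Fin N → κ) → (Fin N → μ) → K :=
  fun a b c => ∏ i, t (a i) (b i) (c i)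

/-- Entries of the tensor power. [folklore] -/
@[simp] theorem kroneckerPow_apply (t : ι → κ → μ → K) (N : ℕ) (a : Fin N → ι) (b : Fin N → κ)
    (c : Fin N → μ) : kroneckerPow t N a b c = ∏ i, t (a i) (b i) (c i) := rfl

/-- `t^{⊗0}` is identically `1`. [folklore] -/
theorem kroneckerPow_zero (t : ι → κ → μ → K) (a : Fin 0 → ι) (b : Fin 0 → κ) (c : Fin 0 → μ) :
    kroneckerPow t 0 a b c = 1 := by
  simp [kroneckerPow]

/-- The **direct sum** `s ⊕ t` of 3-tensors: on `(ι⊕ι') × (κ⊕κ') × (μ⊕μ')`, equal to `s` on the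
`inl` block, to `t` on the `inr` block and `0` on mixed positions (CVZ §1.1, p. 4:
`(v₁+w₁, v₂+w₂, v₃+w₃) ↦ f(v) + g(w)`). [cite: ChristandlVranaZuiddam2023, §1.1] -/
def directSumTensor (s : ι → κ → μ → K) (t : ι' → κ' → μ' → K) :
    ι ⊕ ι' → κ ⊕ κ' → μ ⊕ μ' → K
  | Sum.inl a, Sum.inl b, Sum.inl c => s a b c
  | Sum.inr a, Sum.inr b, Sum.inr c => t a b c
  | _, _, _ => 0

/-- The `inl` block of a direct sum is the first summand. [folklore] -/
@[simp] theorem directSumTensor_inl (s : ι → κ → μ → K) (t : ι' → κ' → μ' → K) (a : ι) (b : κ)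
    (c : μ) : directSumTensor s t (Sum.inl a) (Sum.inl b) (Sum.inl c) = s a b c := rfl

/-- The `inr` block of a direct sum is the second summand. [folklore] -/
@[simp] theorem directSumTensor_inr (s : ι → κ → μ → K) (t : ι' → κ' → μ' → K) (a : ι') (b : κ')
    (c : μ') : directSumTensor s t (Sum.inr a) (Sum.inr b) (Sum.inr c) = t a b c := rfl

/-- Mixed positions of a direct sum vanish. [folklore] -/
@[simp] theorem directSumTensor_inl_inr (s : ι → κ → μ → K) (t : ι' → κ' → μ' → K) (a : ι)
    (b : κ') (c : μ ⊕ μ') : directSumTensor s t (Sum.inl a) (Sum.inr b) c = 0 := by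
  cases c <;> rfl

/-- Mixed positions of a direct sum vanish. [folklore] -/
@[simp] theorem directSumTensor_inr_inl (s : ι → κ → μ → K) (t : ι' → κ' → μ' → K) (a : ι')
    (b : κ) (c : μ ⊕ μ') : directSumTensor s t (Sum.inr a) (Sum.inl b) c = 0 := by
  cases c <;> rfl

variable (K) in
/-- The **unit tensor** `⟨n⟩ = ∑_{i=1}^n eᵢ ⊗ eᵢ ⊗ eᵢ ∈ K^{n×n×n}`: entry `1` at `(i, i, i)` and `0`
elsewhere (CVZ §1.1, p. 4). [cite: ChristandlVranaZuiddam2023, §1.1] -/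
def unitTensor (n : ℕ) : Fin n → Fin n → Fin n → K :=
  fun i j k => if i = j ∧ j = k then 1 else 0

/-- Entries of the unit tensor. [folklore] -/
@[simp] theorem unitTensor_apply (n : ℕ) (i j k : Fin n) :
    unitTensor K n i j k = if i = j ∧ j = k then 1 else 0 := rfl

/-- Diagonal entries of the unit tensor are `1`. [folklore] -/
theorem unitTensor_diag (n : ℕ) (i : Fin n) : unitTensor K n i i i = 1 := by simp

/-- `⟨1⟩` is the constant tensor `1` on the one-point format. [folklore] -/
theorem unitTensor_one (i j k : Fin 1) : unitTensor K 1 i j k = 1 := by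
  simp [Subsingleton.elim i j, Subsingleton.elim j k]

end Operations

/-! ## Restriction, subrank, asymptotic rank -/

section Restriction

variable {K : Type u} [CommSemiring K]
variable {ι κ μ ι' κ' μ' : Type*}

/-- **Restriction** `t ≥ s` ("`t` restricts to `s`"; CVZ §1.1: there are linear maps
`A : K^{ι'} → K^{ι}`, `B`, `C` with `s = t ∘ (A, B, C)`), in coordinates:
`s a' b' c' = ∑_{a,b,c} A a' a * B b' b * C c' c * t a b c` for some matrices `A, B, C`
(Bläser 2013, §4). The source tensor must have finite index types. [cite: ChristandlVranaZuiddam2023, §1.1] -/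
def TensorRestrictsTo [Fintype ι] [Fintype κ] [Fintype μ] (t : ι → κ → μ → K)
    (s : ι' → κ' → μ' → K) : Prop :=
  ∃ (A : ι' → ι → K) (B : κ' → κ → K) (C : μ' → μ → K),
    ∀ a' b' c', s a' b' c' = ∑ a, ∑ b, ∑ c, A a' a * B b' b * C c' c * t a b c

/-- Every tensor restricts to the zero tensor of any format (`A = B = C = 0`). [folklore] -/
theorem TensorRestrictsTo.zero [Fintype ι] [Fintype κ] [Fintype μ] (t : ι → κ → μ → K) :
    TensorRestrictsTo t (0 : ι' → κ' → μ' → K) :=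
  ⟨0, 0, 0, fun _ _ _ => by simp⟩

/-- Restriction is reflexive (`A = B = C = 1`; CVZ §1.2: "`≥` is a preorder"). [cite: ChristandlVranaZuiddam2023, §1.2] -/
theorem TensorRestrictsTo.refl [Fintype ι] [Fintype κ] [Fintype μ] [DecidableEq ι]
    [DecidableEq κ] [DecidableEq μ] (t : ι → κ → μ → K) : TensorRestrictsTo t t := by
  refine ⟨fun a' a => if a = a' then 1 else 0, fun b' b => if b = b' then 1 else 0,
    fun c' c => if c = c' then 1 else 0, fun a' b' c' => ?_⟩
  rw [Finset.sum_eq_single a' (fun a _ ha => by simp [ha]) (by simp),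
    Finset.sum_eq_single b' (fun b _ hb => by simp [hb]) (by simp),
    Finset.sum_eq_single c' (fun c _ hc => by simp [hc]) (by simp)]
  simp

variable (K) in
/-- The **subrank** `Q(t) = max {s ∈ ℕ | ⟨s⟩ ≤ t}` (CVZ §1.1, p. 5). `sSup` over `ℕ` of a set
containing `0`; it is bounded by `min (|ι|, |κ|, |μ|)` (not proved here; `Nat.sSup` of an
unbounded set would be the junk `0`). [cite: ChristandlVranaZuiddam2023, §1.1] -/
def subrank [Fintype ι] [Fintype κ] [Fintype μ] (t : ι → κ → μ → K) : ℕ :=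
  sSup {s : ℕ | TensorRestrictsTo t (unitTensor K s)}

/-- `⟨0⟩ ≤ t` for every `t` (empty format), so the set defining `subrank` is nonempty. [folklore] -/
theorem tensorRestrictsTo_unitTensor_zero [Fintype ι] [Fintype κ] [Fintype μ]
    (t : ι → κ → μ → K) : TensorRestrictsTo t (unitTensor K 0) :=
  ⟨0, 0, 0, fun a' => Fin.elim0 a'⟩

/-- The **asymptotic rank** `R̃(t) = lim_N R(t^{⊗N})^{1/N} = inf_{N ≥ 1} R(t^{⊗N})^{1/N}` (CVZ §1.1,
p. 5; Bläser 2013, §9.2; the limit exists and equals the infimum by Fekete's lemma, `R` being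
sub-multiplicative under `⊗`). Defined as the infimum over `N + 1`, `N : ℕ`. [cite: ChristandlVranaZuiddam2023, §1.1] -/
def asymptoticRank [Fintype ι] [Fintype κ] [Fintype μ] (t : ι → κ → μ → K) : ℝ :=
  ⨅ N : ℕ, ((tensorRank (kroneckerPow t (N + 1)) : ℝ) ^ ((N : ℝ) + 1)⁻¹)

variable (K) in
/-- The **asymptotic subrank** `Q̃(t) = lim_N Q(t^{⊗N})^{1/N} = sup_{N ≥ 1} Q(t^{⊗N})^{1/N}` (CVZ
§1.1, p. 5; Fekete, `Q` being super-multiplicative). Defined as the supremum over `N + 1`;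
`Real.sSup` junk `0` if unbounded (it is bounded by `|ι|` for finite formats, not proved here). [cite: ChristandlVranaZuiddam2023, §1.1] -/
def asymptoticSubrank [Fintype ι] [Fintype κ] [Fintype μ] (t : ι → κ → μ → K) : ℝ :=
  ⨆ N : ℕ, ((subrank K (kroneckerPow t (N + 1)) : ℝ) ^ ((N : ℝ) + 1)⁻¹)

/-- `R̃(t) ≤ R(t)` (the `N = 1` term of the infimum; CVZ §1.1). Uses that `t^{⊗1}` has the same
rank bound as `t`, in the weak form `R̃(t) ≤ R(t^{⊗1})`. [folklore] -/
theorem asymptoticRank_le_tensorRank_pow_one [Fintype ι] [Fintype κ] [Fintype μ]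
    (t : ι → κ → μ → K) : asymptoticRank t ≤ tensorRank (kroneckerPow t 1) := by
  unfold asymptoticRank
  have hb : BddBelow (Set.range fun N : ℕ =>
      ((tensorRank (kroneckerPow t (N + 1)) : ℝ) ^ ((N : ℝ) + 1)⁻¹)) :=
    ⟨0, by rintro _ ⟨N, rfl⟩; positivity⟩
  refine (ciInf_le hb 0).trans_eq ?_
  simp

/-- `0 ≤ R̃(t)`. [folklore] -/
theorem asymptoticRank_nonneg [Fintype ι] [Fintype κ] [Fintype μ] (t : ι → κ → μ → K) :
    0 ≤ asymptoticRank t :=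
  Real.iInf_nonneg fun N => by positivity

end Restriction

/-! ## Universal spectral points -/

section Spectrum

/-- A map defined on all coordinate 3-tensors over `K` with index types in `Type` (all finite
formats `Fin a × …`, their products and sums, up to reindexing), real-valued
(CVZ §1.2: `ξ : {k-tensors over F} → ℝ≥0`; nonnegativity is an axiom of
`IsUniversalSpectralPoint`). Values on infinite index types are never constrained. [cite: ChristandlVranaZuiddam2023, §1.2] -/
abbrev SpectralMap (K : Type u) : Type (max u 1) :=
  ∀ ⦃ι κ μ : Type⦄, (ι → κ → μ → K) → ℝ

variable (K : Type u) [CommSemiring K]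

/-- **Universal spectral point** (Christandl–Vrana–Zuiddam 2023, §1.2, p. 7; Strassen 1988):
"Elements of `Δ(T)` are called universal spectral points, and they correspond precisely to maps
`ξ : {k-tensors over F} → ℝ≥0` satisfying `ξ(s ⊕ t) = ξ(s) + ξ(t)`, `ξ(s ⊗ t) = ξ(s) ξ(t)`,
`ξ(⟨1⟩) = 1`, and `ξ(s) ≤ ξ(t)` whenever `s ≤ t`" (here `k = 3`). The four properties are
required for all tensors with finite index types (in `Type`); `⊕ = directSumTensor`,
`⊗ = kroneckerTensor`, `⟨1⟩ = unitTensor K 1`, `≤` = `TensorRestrictsTo`. The *asymptotic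
spectrum* of all 3-tensors over `K` is the set of such `F` (`asymptoticSpectrum K`). [cite: ChristandlVranaZuiddam2023, §1.2] -/
structure IsUniversalSpectralPoint (F : SpectralMap K) : Prop where
  /-- Values are nonnegative (`ξ : T → ℝ≥0`). -/
  nonneg : ∀ {ι κ μ : Type} [Fintype ι] [Fintype κ] [Fintype μ] (t : ι → κ → μ → K), 0 ≤ F t
  /-- Additivity under direct sum: `ξ(s ⊕ t) = ξ(s) + ξ(t)`. -/
  map_directSum : ∀ {ι κ μ ι' κ' μ' : Type} [Fintype ι] [Fintype κ] [Fintype μ] [Fintype ι']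
    [Fintype κ'] [Fintype μ'] (s : ι → κ → μ → K) (t : ι' → κ' → μ' → K),
    F (directSumTensor s t) = F s + F t
  /-- Multiplicativity under the tensor (Kronecker) product: `ξ(s ⊗ t) = ξ(s) ξ(t)`. -/
  map_kronecker : ∀ {ι κ μ ι' κ' μ' : Type} [Fintype ι] [Fintype κ] [Fintype μ] [Fintype ι']
    [Fintype κ'] [Fintype μ'] (s : ι → κ → μ → K) (t : ι' → κ' → μ' → K),
    F (kroneckerTensor s t) = F s * F t
  /-- Normalisation `ξ(⟨1⟩) = 1`. -/
  map_unitTensor_one : F (unitTensor K 1) = 1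
  /-- Monotonicity under restriction: `s ≤ t → ξ(s) ≤ ξ(t)`. -/
  mono : ∀ {ι κ μ ι' κ' μ' : Type} [Fintype ι] [Fintype κ] [Fintype μ] [Fintype ι']
    [Fintype κ'] [Fintype μ'] (t : ι → κ → μ → K) (s : ι' → κ' → μ' → K),
    TensorRestrictsTo t s → F s ≤ F t

/-- The **asymptotic spectrum** `Δ(T)` of all 3-tensors over `K`: the set of universal spectral
points (CVZ §1.2, Thm. 1.1 with `X = T`). [cite: ChristandlVranaZuiddam2023, §1.2] -/
def asymptoticSpectrum : Set (SpectralMap K) :=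
  {F | IsUniversalSpectralPoint K F}

variable {K}

/-- Membership in the asymptotic spectrum, unfolded. [folklore] -/
theorem mem_asymptoticSpectrum_iff (F : SpectralMap K) :
    F ∈ asymptoticSpectrum K ↔ IsUniversalSpectralPoint K F :=
  Iff.rfl

namespace IsUniversalSpectralPoint

variable {F : SpectralMap K} (hF : IsUniversalSpectralPoint K F)
include hF

/-- A universal spectral point vanishes on zero tensors: `0 ⊕ 0` restricts to and from `0`… more
simply, `t ≥ 0_{fmt}` for every `t`, in particular `⟨1⟩ ≥ 0`, and `0 ⊕ 0 ≥ 0`-type arguments are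
not needed: `F 0 = F (0 ⊕ 0) = 2 F 0` where `0 ⊕ 0` is *equal* to the zero tensor of the sum
format. [folklore] -/
theorem map_zero {ι κ μ : Type} [Fintype ι] [Fintype κ] [Fintype μ] :
    F (0 : ι → κ → μ → K) = 0 := by
  -- `0 ⊕ 0 = 0` on the sum format, and both `0`'s are comparable under restriction with `0`.
  have hsum : directSumTensor (0 : ι → κ → μ → K) (0 : ι → κ → μ → K) = 0 := by
    funext a b c
    rcases a with a | a <;> rcases b with b | b <;> rcases c with c | c <;> rfl
  have h1 : F (directSumTensor (0 : ι → κ → μ → K) (0 : ι → κ → μ → K)) = F (0 : ι → κ → μ → K) +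
      F (0 : ι → κ → μ → K) := hF.map_directSum _ _
  rw [hsum] at h1
  -- the zero tensors of the two formats have the same value: each restricts to the other
  have h2 : F (0 : ι ⊕ ι → κ ⊕ κ → μ ⊕ μ → K) ≤ F (0 : ι → κ → μ → K) :=
    hF.mono _ _ (TensorRestrictsTo.zero _)
  have h3 : F (0 : ι → κ → μ → K) ≤ F (0 : ι ⊕ ι → κ ⊕ κ → μ ⊕ μ → K) :=
    hF.mono _ _ (TensorRestrictsTo.zero _)
  have h4 : F (0 : ι ⊕ ι → κ ⊕ κ → μ ⊕ μ → K) = F (0 : ι → κ → μ → K) := le_antisymm h2 h3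
  linarith

/-- Restriction-equivalent tensors have the same value. [folklore] -/
theorem eq_of_restrictsTo {ι κ μ ι' κ' μ' : Type} [Fintype ι] [Fintype κ] [Fintype μ]
    [Fintype ι'] [Fintype κ'] [Fintype μ'] {t : ι → κ → μ → K} {s : ι' → κ' → μ' → K}
    (h₁ : TensorRestrictsTo t s) (h₂ : TensorRestrictsTo s t) : F s = F t :=
  le_antisymm (hF.mono _ _ h₁) (hF.mono _ _ h₂)

/-- Values on tensor powers: `F (t^{⊗N} ⊗ t) = F (t^{⊗N}) * F t` (multiplicativity, the form in
which powers are used in obstruction arguments, CVZ p. 4). [cite: ChristandlVranaZuiddam2023, §1.1] -/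
theorem map_kronecker_pow_succ {ι κ μ : Type} [Fintype ι] [Fintype κ] [Fintype μ]
    (t : ι → κ → μ → K) (N : ℕ) :
    F (kroneckerTensor (kroneckerPow t N) t) = F (kroneckerPow t N) * F t :=
  hF.map_kronecker _ _

/-- **Obstruction principle** (CVZ §1.1, p. 4: "if `ξ(f) < ξ(g)` then not `f ≥ g`", the
one-shot case). [cite: ChristandlVranaZuiddam2023, §1.1] -/
theorem not_restrictsTo_of_lt {ι κ μ ι' κ' μ' : Type} [Fintype ι] [Fintype κ] [Fintype μ]
    [Fintype ι'] [Fintype κ'] [Fintype μ'] {t : ι → κ → μ → K} {s : ι' → κ' → μ' → K}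
    (h : F t < F s) : ¬ TensorRestrictsTo t s :=
  fun hts => not_le.2 h (hF.mono _ _ hts)

end IsUniversalSpectralPoint

end Spectrum

/-! ## Gauge points and the named facts -/

section Facts

variable (K : Type u) [Field K]

/-- The first **gauge point** `ζ⁽¹⁾(t)`: the rank of the flattening `K^ι → K^{κ×μ}` of `t`, i.e.
the dimension of the span of the slices `(t a · ·)_{a ∈ ι}` (CVZ Example 1.4: `dim V₁`;
Strassen 1988, eq. (3.10)). `Module.finrank` (junk `0` in infinite dimension, irrelevant for
finite formats). [cite: ChristandlVranaZuiddam2023, Example 1.4] -/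
def gaugePoint₁ : SpectralMap K :=
  fun ι κ μ t => Module.finrank K (Submodule.span K (Set.range fun a : ι => fun p : κ × μ => t a p.1 p.2))

/-- The second gauge point `ζ⁽²⁾(t)`: rank of the flattening `K^κ → K^{ι×μ}` (CVZ Example 1.4). [cite: ChristandlVranaZuiddam2023, Example 1.4] -/
def gaugePoint₂ : SpectralMap K :=
  fun ι κ μ t => Module.finrank K (Submodule.span K (Set.range fun b : κ => fun p : ι × μ => t p.1 b p.2))

/-- The third gauge point `ζ⁽³⁾(t)`: rank of the flattening `K^μ → K^{ι×κ}` (CVZ Example 1.4). [cite: ChristandlVranaZuiddam2023, Example 1.4] -/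
def gaugePoint₃ : SpectralMap K :=
  fun ι κ μ t => Module.finrank K (Submodule.span K (Set.range fun c : μ => fun p : ι × κ => t p.1 p.2 c))

/-- Gauge points vanish on zero tensors (the span of zero slices is `⊥`). [folklore] -/
theorem gaugePoint₁_zero {ι κ μ : Type} : gaugePoint₁ K (0 : ι → κ → μ → K) = 0 := by
  unfold gaugePoint₁
  have hspan : Submodule.span K
      (Set.range fun a : ι => fun p : κ × μ => (0 : ι → κ → μ → K) a p.1 p.2) = ⊥ := by
    refine Submodule.span_eq_bot.2 ?_
    rintro _ ⟨a, rfl⟩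
    funext p
    rfl
  rw [hspan, finrank_bot K, Nat.cast_zero]

/-- **Gauge points are universal spectral points** (Christandl–Vrana–Zuiddam 2023, Example 1.4:
"The maps `ζ⁽ⁱ⁾` are universal spectral points and are named gauge points"; Strassen 1988,
eq. (3.10)). In particular the asymptotic spectrum of all 3-tensors over a field is nonempty.
Known theorem; statement only. [cite: ChristandlVranaZuiddam2023, Example 1.4] -/
def gaugePoint_isUniversalSpectralPoint : Prop :=
  IsUniversalSpectralPoint K (gaugePoint₁ K) ∧ IsUniversalSpectralPoint K (gaugePoint₂ K) ∧
    IsUniversalSpectralPoint K (gaugePoint₃ K)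

/-- Consequence: the asymptotic spectrum is nonempty. [cite: ChristandlVranaZuiddam2023, Example 1.4] -/
theorem gaugePoint_isUniversalSpectralPoint.nonempty (h : gaugePoint_isUniversalSpectralPoint K) :
    (asymptoticSpectrum K).Nonempty :=
  ⟨gaugePoint₁ K, h.1⟩

/-- **Strassen duality for the asymptotic rank** (Christandl–Vrana–Zuiddam 2023, Prop. 1.6, for
the semiring `X = T` of all tensors; Strassen 1988, Thm. 3.8): for every 3-tensor `t` over the
field `K` (finite index types), `R̃(t) = max_{ξ ∈ Δ(T)} ξ(t)` — every universal spectral point is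
at most the asymptotic rank at `t`, and the maximum is attained. Known theorem; statement only. [cite: ChristandlVranaZuiddam2023, Prop. 1.6] -/
def strassen_duality_asymptoticRank : Prop :=
  ∀ {ι κ μ : Type} [Fintype ι] [Fintype κ] [Fintype μ] (t : ι → κ → μ → K),
    (∀ F, IsUniversalSpectralPoint K F → F t ≤ asymptoticRank t) ∧
      ∃ F, IsUniversalSpectralPoint K F ∧ F t = asymptoticRank t

/-- **Strassen duality for the asymptotic subrank** (Christandl–Vrana–Zuiddam 2023, Prop. 1.6;
Strassen 1988, Thm. 3.8): `Q̃(t) = min_{ξ ∈ Δ(T)} ξ(t)`. Known theorem; statement only. [cite: ChristandlVranaZuiddam2023, Prop. 1.6] -/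
def strassen_duality_asymptoticSubrank : Prop :=
  ∀ {ι κ μ : Type} [Fintype ι] [Fintype κ] [Fintype μ] (t : ι → κ → μ → K),
    (∀ F, IsUniversalSpectralPoint K F → asymptoticSubrank K t ≤ F t) ∧
      ∃ F, IsUniversalSpectralPoint K F ∧ F t = asymptoticSubrank K t

variable {K}

/-- From duality: a common upper bound on all universal spectral points at `t` bounds the
asymptotic rank (the use made of `Δ(T)` in the route `MatrixMultiplication/AsymptoticSpectrum`). [cite: ChristandlVranaZuiddam2023, Prop. 1.6] -/
theorem strassen_duality_asymptoticRank.asymptoticRank_le (h : strassen_duality_asymptoticRank K)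
    {ι κ μ : Type} [Fintype ι] [Fintype κ] [Fintype μ] (t : ι → κ → μ → K) {r : ℝ}
    (hr : ∀ F, IsUniversalSpectralPoint K F → F t ≤ r) : asymptoticRank t ≤ r := by
  obtain ⟨F, hF, hFt⟩ := (h t).2
  exact hFt ▸ hr F hF

/-- From duality: spectral points are sandwiched, `Q̃(t) ≤ ξ(t) ≤ R̃(t)` (CVZ p. 5: "Spectral
points … are thus between asymptotic subrank and asymptotic rank"). [cite: ChristandlVranaZuiddam2023, §1.1] -/
theorem asymptoticSubrank_le_asymptoticRank (h₁ : strassen_duality_asymptoticRank K)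
    (h₂ : strassen_duality_asymptoticSubrank K) {ι κ μ : Type} [Fintype ι] [Fintype κ]
    [Fintype μ] (t : ι → κ → μ → K) : asymptoticSubrank K t ≤ asymptoticRank t := by
  obtain ⟨F, hF, hFt⟩ := (h₁ t).2
  exact ((h₂ t).1 F hF).trans hFt.le

end Facts

end Literature.Computability.AlgebraicComplexity

end
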